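import Literature.AlgebraicGeometry.Motives.JacobianAbelJacobiSumGaloisPullback
import Literature.AlgebraicGeometry.Motives.GaloisCoverPointDivisorPullback
import Literature.AlgebraicGeometry.Motives.FiniteQuotientFunctionField
import HarnessLib

/-!
# Naturality of Abel–Jacobi sums along a Galois cover, UNCONDITIONAL: `aj_c(p^* E) = p^*(aj_{p c}(E))`

Layer `Literature/AlgebraicGeometry/Motives`, namespace `Literature.AlgebraicGeometry.Motives.Jacobian`.
THEOREMS ONLY (no definition, no named fact, no instance, no `sorry`).

★ `Jacobian.ajSum_pullback_eq_map_of_pin` (G4 §2) proves the naturality `aj_c(p^*E) = t(aj_{pc}(E))` of the Abel–Jacobi sum along a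
Galois cover `p : X → Y = X/Δ` of smooth projective complex curves under two explicit ramification binders; both are now theorems:
`hram` («`ord_x(p^*E) = #Stab_Δ(x) · ord_{px}(E)`», ★ `CurvePlaces.ordAt_pullback_eq_card_stabilizer_mul`, [Hartshorne1977] IV.2 Prop. 2.2,
given the degree identity `[K(X):K(Y)] = |Δ|` = ★ `finrank_functionField_of_isSepQuotient`, [Serre1988] III no. 12) and `hfib` (the fibres of
`p(ℂ)` are `Δ`-orbits, ★ `CurvePlaces.exists_act_map_eq_of_map_eq`, [SGA1] V 1.1).  This file discharges them:

* `ajSum_pullback_eq_map` — **`aj_c(p^* E) = t(aj_{p c}(E))`** for `X` projective, `deg E = 0`, with NO ramification hypothesis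
  ([Lange2023] §4.5.2 eq. (4.9): the naturality square behind `N̂_f φ_{Θ′} = φ_Θ f^*`).

## References
* [Lange2023AbelianVarietiesComplex] H. Lange, *Abelian Varieties over the Complex Numbers* (2023), §4.5.2 eq. (4.9) (p. 227).
* [LangeRodriguez2022] H. Lange, R. E. Rodríguez, *Decomposition of Jacobians by Prym Varieties* (2022), §3.5.1 Prop. 3.5.1 (p. 65).
* [Hartshorne1977] R. Hartshorne, *Algebraic Geometry* (1977), IV.2 Prop. 2.2.
-/

set_option autoImplicit false

noncomputable section

universe u

open CategoryTheory AlgebraicGeometry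

namespace Literature.AlgebraicGeometry.Motives

namespace Jacobian

variable {X Y : SchemeOver ℂ} (𝒥X : Jacobian X) (𝒥Y : Jacobian Y)

/-- **Naturality of the Abel–Jacobi sum along a Galois cover (unconditional):** for a Galois cover `p : X → Y = X/Δ` of smooth
projective complex curves (`act` a finite group of automorphisms of `X` acting faithfully, `p` its quotient for separated test
objects, `X` projective), `t : J_Y → J_X` pinned by `Nm_p ≫ t = Σ_δ δ_*` (= `p^*`, [LangeRodriguez2022] Prop. 3.5.1), a complex point
`c` of `X` and a Cartier divisor `E` of degree `0` on `Y`: `aj_c(p^* E) = t(aj_{p c}(E))` — ★ `ajSum_pullback_eq_map_of_pin` with its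
two ramification binders discharged by ★ `CurvePlaces.ordAt_pullback_eq_card_stabilizer_mul` (fed with ★
`finrank_functionField_of_isSepQuotient`, the cover by `Δ`-stable affine opens coming from projectivity) and ★
`CurvePlaces.exists_act_map_eq_of_map_eq`. [cite: Lange2023AbelianVarietiesComplex, §4.5.2 eq. (4.9) (p. 227)]
[cite: LangeRodriguez2022, §3.5.1 Prop. 3.5.1 (p. 65)] [cite: Hartshorne1977, IV.2 Prop. 2.2] -/
theorem ajSum_pullback_eq_map (hXp : IsProjectiveOver X) [IsIntegral X.left] [IsLocallyNoetherian X.left]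
    [SmoothOfRelativeDimension 1 X.hom] [IsProper X.hom] [IsIntegral Y.left] [IsLocallyNoetherian Y.left]
    [SmoothOfRelativeDimension 1 Y.hom] [IsProper Y.hom]
    (Δ : Type) [Group Δ] [Fintype Δ] (act : Δ →* Aut X) (hact : Function.Injective act)
    (p : X ⟶ Y) (hp : IsSepQuotient (fun δ : Δ => act δ) p) [IsDominant p.left]
    (t : 𝒥Y.J ⟶ 𝒥X.J) (ht : 𝒥X.pushforward 𝒥Y p ≫ t = ∑ δ : Δ, 𝒥X.pushforward 𝒥X (act δ).hom)
    (c : AlgPoints X ℂ) (E : CartierDivisor Y.left) (hE : CartierDivisor.degree Y E = 0) :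
    𝒥X.ajSum c (E.pullback p.left) = AlgPoints.map t.hom.hom.hom (𝒥Y.ajSum (AlgPoints.map p c) E) :=
  ajSum_pullback_eq_map_of_pin 𝒥X 𝒥Y Δ act hact p hp t ht
    (CurvePlaces.ordAt_pullback_eq_card_stabilizer_mul act p hXp hp
      (finrank_functionField_of_isSepQuotient act hact
        (Literature.AlgebraicGeometry.RelativeSpec.ActionOver.forall_exists_stableAffineOpen_of_isProjectiveOver _ hXp)
        p inferInstance hp))
    (CurvePlaces.exists_act_map_eq_of_map_eq act p hXp hp) c E hE

end Jacobian

end Literature.AlgebraicGeometry.Motives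

end
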